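import Summits.AtomisticToContinuum.FouriersLaw.Theorems.PhononMeanFreePathIncoherentChannelLightConeReduction
import Summits.AtomisticToContinuum.FouriersLaw.Theorems.PhononMeanFreePathIncoherentChannelLightConeHelper5
import Summits.AtomisticToContinuum.FouriersLaw.Theorems.JunctionLocalityNonBallisticLightConeKinematics

/-!
# Light-cone stub, helper 6: Gibbs-mean tools — stationarity of the two coupled copies and the rate moments

Helper for the registered stub `stub_lightCone` of line `two-horizons-forecast-loss`
(crux `PhononMeanFreePath.IncoherentChannel`, stmt-AtomisticToContinuum-11811), registered sub-goal
`lightCone_rate_moment`.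

The pathwise light cone (helper 4) controls the far discrepancy by `e^{A} A^N/N!` with the random
clock `A = 4∫₀ᵗ c(r) dr`, `c(r) = 1 + 5((ω₂+1) + 8(lam+β)(‖q(r)‖² + ‖q̃(r)‖²))`, where `q(r), q̃(r)`
are the positions of the two copies of the Langevin chain driven by the SAME Brownian pair and
started from `z ~ μ₀` resp. from `z̃` (= `z` with `p₀` resampled). Both copies are STATIONARY with the
Gibbs law (`μ₀.bind K_r = μ₀`, and `z̃ ~ μ₀` by helper 1), so every moment of `c(r)` is a static
Gibbs moment of `‖q‖_∞`, which helper 5 bounds by `(N+1) ×` an `N`-uniform constant. This file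
provides the plumbing:

* `lightCone_lintegral_mul_le` — Cauchy–Schwarz for lower Lebesgue integrals, packaged;
* `lightCone_pow_intervalIntegral_le` — Jensen for the clock: `(∫₀ᵗ f)^{2^k} ≤ t^{2^k-1} ∫₀ᵗ f^{2^k}`
  (iterated Cauchy–Schwarz, the tree's `NonBallistic.sq_intervalIntegral_le_mul_intervalIntegral_sq`);
* `lightCone_add_three_pow_le`, `lightCone_norm_pow_le_sum` — elementary;
* `lightCone_lintegral_solMap_fst`, `lightCone_lintegral_solMap_resample` — **stationarity of both
  copies**: `E[g(Φ_r z)] = E[g(Φ_r z̃)] = ∫ g dμ₀` for measurable `g ≥ 0`;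
* `lightCone_rate_moment` (registered) — `E[c(r)^p] ≤ C_p · (N+1)` for all `N`, all `r ≥ 0`.
-/

noncomputable section

namespace Summit.AtomisticToContinuum.FouriersLaw.Theorems.PhononMeanFreePath

open MeasureTheory ProbabilityTheory Set Filter Topology
open scoped NNReal ENNReal
open Literature.MathematicalPhysics.KineticTheory.HeatConduction
open Literature.MathematicalPhysics.KineticTheory Literature.Probability.Process OscillatorChain
open Summit.AtomisticToContinuum.FouriersLaw.Theorems.SubdiffusiveBondHeat
  (pinnedChain_gibbsMeasure_bind_transitionKernel)

/-! ### Elementary inequalities -/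

/-- **Cauchy–Schwarz for lower Lebesgue integrals**, packaged with real square bounds:
`∫ f² ≤ a²`, `∫ g² ≤ b²` (`a, b ≥ 0`) give `∫ f g ≤ a b`. -/
theorem lightCone_lintegral_mul_le {α : Type*} [MeasurableSpace α] {μ : Measure α} {f g : α → ℝ≥0∞}
    (hf : AEMeasurable f μ) (hg : AEMeasurable g μ) {a b : ℝ} (ha : 0 ≤ a) (hb : 0 ≤ b)
    (hfa : ∫⁻ x, f x ^ 2 ∂μ ≤ ENNReal.ofReal (a ^ 2)) (hgb : ∫⁻ x, g x ^ 2 ∂μ ≤ ENNReal.ofReal (b ^ 2)) :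
    ∫⁻ x, f x * g x ∂μ ≤ ENNReal.ofReal (a * b) := by
  have h := ENNReal.lintegral_mul_le_Lp_mul_Lq μ Real.HolderConjugate.two_two hf hg
  simp only [Pi.mul_apply, ENNReal.rpow_two] at h
  refine h.trans ?_
  have h2 : (0 : ℝ) ≤ 1 / 2 := by norm_num
  have hA : (∫⁻ x, f x ^ 2 ∂μ) ^ (1 / 2 : ℝ) ≤ ENNReal.ofReal a := by
    refine (ENNReal.rpow_le_rpow hfa h2).trans_eq ?_
    rw [ENNReal.ofReal_rpow_of_nonneg (sq_nonneg a) h2, ← Real.sqrt_eq_rpow, Real.sqrt_sq ha]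
  have hB : (∫⁻ x, g x ^ 2 ∂μ) ^ (1 / 2 : ℝ) ≤ ENNReal.ofReal b := by
    refine (ENNReal.rpow_le_rpow hgb h2).trans_eq ?_
    rw [ENNReal.ofReal_rpow_of_nonneg (sq_nonneg b) h2, ← Real.sqrt_eq_rpow, Real.sqrt_sq hb]
  rw [ENNReal.ofReal_mul ha]
  exact mul_le_mul' hA hB

/-- **Jensen for the clock**: `(∫₀ᵗ f)^{2^k} ≤ t^{2^k - 1} ∫₀ᵗ f^{2^k}` for continuous `f ≥ 0`, `t ≥ 0`
(iterated Cauchy–Schwarz). -/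
theorem lightCone_pow_intervalIntegral_le {f : ℝ → ℝ} (hf : Continuous f) (hf0 : ∀ r, 0 ≤ f r) {t : ℝ}
    (ht : 0 ≤ t) (k : ℕ) :
    (∫ r in (0:ℝ)..t, f r) ^ (2 ^ k) ≤ t ^ (2 ^ k - 1) * ∫ r in (0:ℝ)..t, f r ^ (2 ^ k) := by
  induction k with
  | zero => simp
  | succ k ih =>
    have hI0 : 0 ≤ ∫ r in (0:ℝ)..t, f r := intervalIntegral.integral_nonneg ht fun r _ => hf0 r
    have hcs0 := Summit.AtomisticToContinuum.FouriersLaw.Theorems.NonBallistic.sq_intervalIntegral_le_mul_intervalIntegral_sq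
      (f := fun r => f r ^ (2 ^ k)) (hf.pow (2 ^ k)) ht
    have e : ∫ r in (0:ℝ)..t, (f r ^ 2 ^ k) ^ 2 = ∫ r in (0:ℝ)..t, f r ^ 2 ^ (k + 1) := by
      refine intervalIntegral.integral_congr fun r _ => ?_
      rw [← pow_mul, pow_succ]
    have hcs : (∫ r in (0:ℝ)..t, f r ^ (2 ^ k)) ^ 2 ≤ t * ∫ r in (0:ℝ)..t, f r ^ 2 ^ (k + 1) := by
      rw [← e]; exact hcs0
    have h1 : ((∫ r in (0:ℝ)..t, f r) ^ (2 ^ k)) ^ 2 ≤ (t ^ (2 ^ k - 1) * ∫ r in (0:ℝ)..t, f r ^ (2 ^ k)) ^ 2 :=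
      pow_le_pow_left₀ (pow_nonneg hI0 _) ih 2
    have hk1 : 1 ≤ 2 ^ k := Nat.one_le_two_pow
    calc (∫ r in (0:ℝ)..t, f r) ^ 2 ^ (k + 1) = ((∫ r in (0:ℝ)..t, f r) ^ (2 ^ k)) ^ 2 := by
          rw [← pow_mul]; ring_nf
      _ ≤ (t ^ (2 ^ k - 1) * ∫ r in (0:ℝ)..t, f r ^ (2 ^ k)) ^ 2 := h1
      _ = t ^ (2 * (2 ^ k - 1)) * (∫ r in (0:ℝ)..t, f r ^ (2 ^ k)) ^ 2 := by ring
      _ ≤ t ^ (2 * (2 ^ k - 1)) * (t * ∫ r in (0:ℝ)..t, f r ^ 2 ^ (k + 1)) :=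
          mul_le_mul_of_nonneg_left hcs (by positivity)
      _ = t ^ (2 ^ (k + 1) - 1) * ∫ r in (0:ℝ)..t, f r ^ 2 ^ (k + 1) := by
          rw [← mul_assoc, ← pow_succ]
          congr 2
          omega

/-- `(a + b + c)^p ≤ 3^{p-1}(a^p + b^p + c^p)` for `a, b, c ≥ 0`, `p ≥ 1` (power mean). -/
theorem lightCone_add_three_pow_le {a b c : ℝ} (ha : 0 ≤ a) (hb : 0 ≤ b) (hc : 0 ≤ c) {p : ℕ} (hp : 1 ≤ p) :
    (a + b + c) ^ p ≤ 3 ^ (p - 1) * (a ^ p + b ^ p + c ^ p) := by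
  have h := Real.pow_arith_mean_le_arith_mean_pow Finset.univ (fun _ : Fin 3 => (1 / 3 : ℝ)) ![a, b, c]
    (fun _ _ => by norm_num) (by norm_num [Fin.sum_univ_three]) (fun i _ => by fin_cases i <;> simp [ha, hb, hc]) p
  simp only [Fin.sum_univ_three, Matrix.cons_val_zero, Matrix.cons_val_one, Matrix.cons_val] at h
  have e1 : (1 / 3 * a + 1 / 3 * b + 1 / 3 * c) ^ p = (a + b + c) ^ p / 3 ^ p := by
    rw [show 1 / 3 * a + 1 / 3 * b + 1 / 3 * c = (a + b + c) / 3 by ring, div_pow]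
  rw [e1, div_le_iff₀ (by positivity)] at h
  obtain ⟨p', rfl⟩ : ∃ p', p = p' + 1 := ⟨p - 1, by omega⟩
  rw [Nat.add_sub_cancel]
  calc (a + b + c) ^ (p' + 1) ≤ (1 / 3 * a ^ (p' + 1) + 1 / 3 * b ^ (p' + 1) + 1 / 3 * c ^ (p' + 1)) * 3 ^ (p' + 1) := h
    _ = 3 ^ p' * (a ^ (p' + 1) + b ^ (p' + 1) + c ^ (p' + 1)) := by ring

/-- The sup norm is dominated by the sum of the coordinates' even powers:
`‖q‖^{2k} ≤ ∑_i q_i^{2k}`. -/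
theorem lightCone_norm_pow_le_sum {n : ℕ} (q : Fin (n + 1) → ℝ) (k : ℕ) : ‖q‖ ^ (2 * k) ≤ ∑ i, q i ^ (2 * k) := by
  obtain ⟨i₀, -, hi₀⟩ := Finset.exists_mem_eq_sup (Finset.univ : Finset (Fin (n + 1))) Finset.univ_nonempty
    fun b => ‖q b‖₊
  have hnorm : ‖q‖ = |q i₀| := by
    rw [Pi.norm_def, hi₀, coe_nnnorm, Real.norm_eq_abs]
  rw [hnorm, Even.pow_abs ⟨k, by ring⟩]
  exact Finset.single_le_sum (f := fun i => q i ^ (2 * k)) (fun i _ => Even.pow_nonneg ⟨k, by ring⟩ _)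
    (Finset.mem_univ i₀)

/-! ### Stationarity of the two coupled copies -/

section Stationary

variable {ω₂ lam β γ : ℝ} (hω : 0 < ω₂) (hl : 0 ≤ lam) (hβ : 0 ≤ β) (hγ : 0 ≤ γ) (N : ℕ)
include hω hl hβ hγ

/-- Joint measurability of `(x, ω) ↦ Φ_r(x.1, B(ω))`. -/
theorem lightCone_measurable_solMap_fst (T : ℝ) (r : ℝ) :
    Measurable fun p : (PhaseSpace (N + 1) × ℝ) × WienerPair =>
      (pinnedChain ω₂ lam β γ).solMap (N + 1) T T r p.1.1 (pairPath p.2) := by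
  have h2 : Measurable fun p : (PhaseSpace (N + 1) × ℝ) × WienerPair => (p.1.1, p.2) :=
    (measurable_fst.comp measurable_fst).prodMk measurable_snd
  have h := (pinnedChain_measurable_solMap_pairPath hω hl hβ hγ (N + 1) T T r).comp h2
  exact h

/-- Joint measurability of `(x, ω) ↦ Φ_r(z̃, B(ω))`, `z̃` the resampled state. -/
theorem lightCone_measurable_solMap_resample (T : ℝ) (r : ℝ) :
    Measurable fun p : (PhaseSpace (N + 1) × ℝ) × WienerPair =>
      (pinnedChain ω₂ lam β γ).solMap (N + 1) T T r ((p.1.1.1, Function.update p.1.1.2 0 p.1.2) : PhaseSpace (N + 1))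
        (pairPath p.2) := by
  have h2 : Measurable fun p : (PhaseSpace (N + 1) × ℝ) × WienerPair =>
      (((p.1.1.1, Function.update p.1.1.2 0 p.1.2) : PhaseSpace (N + 1)), p.2) :=
    ((lightCone_measurable_resample 0).comp measurable_fst).prodMk measurable_snd
  have h := (pinnedChain_measurable_solMap_pairPath hω hl hβ hγ (N + 1) T T r).comp h2
  exact h

variable {T : ℝ} (hT : 0 < T)
include hT

/-- **Stationarity in lintegral form**: `∫ (∫ g(Φ_r(z,B)) dW) dμ₀(z) = ∫ g dμ₀` for measurable `g ≥ 0`. -/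
theorem lightCone_lintegral_solMap_gibbs (r : ℝ≥0) {g : PhaseSpace (N + 1) → ℝ≥0∞} (hg : Measurable g) :
    ∫⁻ z, ∫⁻ ω, g ((pinnedChain ω₂ lam β γ).solMap (N + 1) T T r z (pairPath ω)) ∂wienerPair
        ∂((pinnedChain ω₂ lam β γ).gibbsMeasure (N + 1) T) =
      ∫⁻ z, g z ∂((pinnedChain ω₂ lam β γ).gibbsMeasure (N + 1) T) := by
  set κ := (pinnedChain ω₂ lam β γ).transitionKernel (N + 1) T T r with hκ
  have hbind := pinnedChain_gibbsMeasure_bind_transitionKernel hω hl hβ hγ (Nat.succ_pos N) hT r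
  have h1 : ∀ z, ∫⁻ ω, g ((pinnedChain ω₂ lam β γ).solMap (N + 1) T T r z (pairPath ω)) ∂wienerPair = ∫⁻ y, g y ∂κ z :=
    fun z => (pinnedChain_lintegral_transitionKernel hω hl hβ hγ (N + 1) T T r z hg).symm
  simp_rw [h1]
  rw [← Measure.lintegral_bind κ.measurable.aemeasurable hg.aemeasurable, hbind]

/-- **Stationarity of the first copy**: `E[g(Φ_r(z, B))] = ∫ g dμ₀` over `(μ₀ ⊗ ν) ⊗ W`. -/
theorem lightCone_lintegral_solMap_fst (r : ℝ≥0) {g : PhaseSpace (N + 1) → ℝ≥0∞} (hg : Measurable g) :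
    ∫⁻ p, g ((pinnedChain ω₂ lam β γ).solMap (N + 1) T T r p.1.1 (pairPath p.2))
        ∂((((pinnedChain ω₂ lam β γ).gibbsMeasure (N + 1) T).prod (gaussianReal 0 T.toNNReal)).prod wienerPair) =
      ∫⁻ z, g z ∂((pinnedChain ω₂ lam β γ).gibbsMeasure (N + 1) T) := by
  set μ₀ := (pinnedChain ω₂ lam β γ).gibbsMeasure (N + 1) T with hμ₀
  haveI : IsProbabilityMeasure μ₀ := pinnedChain_isProbabilityMeasure_gibbsMeasure hω hl hβ γ (N + 1) hT
  have hm := lightCone_measurable_solMap_fst hω hl hβ hγ N T (r : ℝ)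
  rw [lintegral_prod _ (show AEMeasurable (fun p : (PhaseSpace (N + 1) × ℝ) × WienerPair =>
    g ((pinnedChain ω₂ lam β γ).solMap (N + 1) T T r p.1.1 (pairPath p.2))) _ from (hg.comp hm).aemeasurable)]
  have hG : Measurable fun z : PhaseSpace (N + 1) =>
      ∫⁻ ω, g ((pinnedChain ω₂ lam β γ).solMap (N + 1) T T r z (pairPath ω)) ∂wienerPair :=
    (hg.comp (pinnedChain_measurable_solMap_pairPath hω hl hβ hγ (N + 1) T T r)).lintegral_prod_right'
  have h2 : ∫⁻ x : PhaseSpace (N + 1) × ℝ, ∫⁻ ω, g ((pinnedChain ω₂ lam β γ).solMap (N + 1) T T r x.1 (pairPath ω))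
      ∂wienerPair ∂(μ₀.prod (gaussianReal 0 T.toNNReal)) =
      ∫⁻ z, ∫⁻ ω, g ((pinnedChain ω₂ lam β γ).solMap (N + 1) T T r z (pairPath ω)) ∂wienerPair ∂μ₀ := by
    rw [← lintegral_map hG measurable_fst, Measure.map_fst_prod, measure_univ, one_smul]
  rw [h2]
  exact lightCone_lintegral_solMap_gibbs hω hl hβ hγ N hT r hg

/-- **Stationarity of the resampled copy**: `E[g(Φ_r(z̃, B))] = ∫ g dμ₀` over `(μ₀ ⊗ ν) ⊗ W`
(`z̃ ~ μ₀`, helper 1). -/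
theorem lightCone_lintegral_solMap_resample (r : ℝ≥0) {g : PhaseSpace (N + 1) → ℝ≥0∞} (hg : Measurable g) :
    ∫⁻ p, g ((pinnedChain ω₂ lam β γ).solMap (N + 1) T T r
        ((p.1.1.1, Function.update p.1.1.2 0 p.1.2) : PhaseSpace (N + 1)) (pairPath p.2))
        ∂((((pinnedChain ω₂ lam β γ).gibbsMeasure (N + 1) T).prod (gaussianReal 0 T.toNNReal)).prod wienerPair) =
      ∫⁻ z, g z ∂((pinnedChain ω₂ lam β γ).gibbsMeasure (N + 1) T) := by
  set μ₀ := (pinnedChain ω₂ lam β γ).gibbsMeasure (N + 1) T with hμ₀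
  have hm := lightCone_measurable_solMap_resample hω hl hβ hγ N T (r : ℝ)
  rw [lintegral_prod _ (show AEMeasurable (fun p : (PhaseSpace (N + 1) × ℝ) × WienerPair =>
    g ((pinnedChain ω₂ lam β γ).solMap (N + 1) T T r ((p.1.1.1, Function.update p.1.1.2 0 p.1.2) : PhaseSpace (N + 1))
      (pairPath p.2))) _ from (hg.comp hm).aemeasurable)]
  have hG : Measurable fun z : PhaseSpace (N + 1) =>
      ∫⁻ ω, g ((pinnedChain ω₂ lam β γ).solMap (N + 1) T T r z (pairPath ω)) ∂wienerPair :=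
    (hg.comp (pinnedChain_measurable_solMap_pairPath hω hl hβ hγ (N + 1) T T r)).lintegral_prod_right'
  have hmap := lightCone_gibbs_map_resample (γ := γ) hω hl hβ hT (0 : Fin (N + 1)) (n := N)
  have h2 : ∫⁻ x : PhaseSpace (N + 1) × ℝ, ∫⁻ ω, g ((pinnedChain ω₂ lam β γ).solMap (N + 1) T T r
      ((x.1.1, Function.update x.1.2 0 x.2) : PhaseSpace (N + 1)) (pairPath ω)) ∂wienerPair
      ∂(μ₀.prod (gaussianReal 0 T.toNNReal)) =
      ∫⁻ z, ∫⁻ ω, g ((pinnedChain ω₂ lam β γ).solMap (N + 1) T T r z (pairPath ω)) ∂wienerPair ∂μ₀ := by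
    rw [← lintegral_map hG (lightCone_measurable_resample 0), hmap]
  rw [h2]
  exact lightCone_lintegral_solMap_gibbs hω hl hβ hγ N hT r hg

omit hω hl hβ hγ hT in
/-- The Gibbs mean of an even power of the sup norm of the positions is at most `(N+1) ×` the
`N`-uniform one-site constant of helper 5. -/
theorem lightCone_lintegral_norm_pow_le (k : ℕ) {C : ℝ}
    (hC : ∀ i : Fin (N + 1), Integrable (fun z : PhaseSpace (N + 1) => (z.1 i) ^ (2 * k))
        ((pinnedChain ω₂ lam β γ).gibbsMeasure (N + 1) T) ∧
      ∫ z, (z.1 i) ^ (2 * k) ∂((pinnedChain ω₂ lam β γ).gibbsMeasure (N + 1) T) ≤ C) :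
    ∫⁻ z, ENNReal.ofReal (‖z.1‖ ^ (2 * k)) ∂((pinnedChain ω₂ lam β γ).gibbsMeasure (N + 1) T) ≤
      ENNReal.ofReal (C * (N + 1)) := by
  set μ₀ := (pinnedChain ω₂ lam β γ).gibbsMeasure (N + 1) T with hμ₀
  have hev : ∀ (z : PhaseSpace (N + 1)) (i : Fin (N + 1)), 0 ≤ (z.1 i) ^ (2 * k) :=
    fun z i => Even.pow_nonneg ⟨k, by ring⟩ _
  calc ∫⁻ z, ENNReal.ofReal (‖z.1‖ ^ (2 * k)) ∂μ₀
      ≤ ∫⁻ z, ∑ i, ENNReal.ofReal ((z.1 i) ^ (2 * k)) ∂μ₀ := by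
        refine lintegral_mono fun z => ?_
        rw [← ENNReal.ofReal_sum_of_nonneg (fun i _ => hev z i)]
        exact ENNReal.ofReal_le_ofReal (lightCone_norm_pow_le_sum z.1 k)
    _ = ∑ i, ∫⁻ z, ENNReal.ofReal ((z.1 i) ^ (2 * k)) ∂μ₀ :=
        lintegral_finsetSum' _ fun i _ => (Measurable.ennreal_ofReal (by fun_prop)).aemeasurable
    _ ≤ ∑ _i : Fin (N + 1), ENNReal.ofReal C := by
        refine Finset.sum_le_sum fun i _ => ?_
        rw [← ofReal_integral_eq_lintegral_ofReal (hC i).1 (Eventually.of_forall fun z => hev z i)]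
        exact ENNReal.ofReal_le_ofReal (hC i).2
    _ = ENNReal.ofReal (C * (N + 1)) := by
        rw [Finset.sum_const, Finset.card_univ, Fintype.card_fin, nsmul_eq_mul, mul_comm,
          ENNReal.ofReal_mul' (by positivity)]
        congr 1
        rw [show ((N : ℝ) + 1) = ((N + 1 : ℕ) : ℝ) by push_cast; ring, ENNReal.ofReal_natCast]

end Stationary

/-- **Registered helper `lightCone_rate_moment` — the moments of the light-cone rate are
`O(N)`, uniformly in time.** For `P = pinnedChain ω₂ lam β γ` (`ω₂ > 0`, `lam, β, γ ≥ 0`), `T > 0`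
and every `p ≥ 1` there is `C ≥ 0` with, for all `N` and all times `r ≥ 0`,
`E[c(r)^p] ≤ C (N+1)` where `c(r) = 1 + 5((ω₂+1) + 8(lam+β)(‖q(r)‖² + ‖q̃(r)‖²))` is the local
rate of the pathwise light cone along the two stationary copies (same noise; `z ~ μ₀`, `z̃` = `z`
with `p₀` resampled), the expectation being over `(μ₀ ⊗ N(0,T)) ⊗ W`. -/
theorem lightCone_rate_moment : ∀ ω₂ lam β γ : ℝ, 0 < ω₂ → 0 ≤ lam → 0 ≤ β → 0 ≤ γ → ∀ T : ℝ, 0 < T →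
    ∀ p : ℕ, 1 ≤ p → ∃ C : ℝ, 0 ≤ C ∧ ∀ (N : ℕ) (r : ℝ), 0 ≤ r →
      ∫⁻ q, ENNReal.ofReal ((1 + 5 * ((ω₂ + 1) + 8 * (lam + β) *
          (‖((pinnedChain ω₂ lam β γ).solMap (N + 1) T T r q.1.1 (pairPath q.2)).1‖ ^ 2 +
            ‖((pinnedChain ω₂ lam β γ).solMap (N + 1) T T r
              ((q.1.1.1, Function.update q.1.1.2 0 q.1.2) : PhaseSpace (N + 1)) (pairPath q.2)).1‖ ^ 2))) ^ p)
        ∂((((pinnedChain ω₂ lam β γ).gibbsMeasure (N + 1) T).prod (ProbabilityTheory.gaussianReal 0 T.toNNReal)).prod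
          wienerPair) ≤ ENNReal.ofReal (C * (N + 1)) := by
  intro ω₂ lam β γ hω hl hβ hγ T hT p hp
  obtain ⟨Q, hQ⟩ := lightCone_gibbs_position_moments ω₂ lam β γ hω hl hβ T hT p
  set c₁ : ℝ := 1 + 5 * (ω₂ + 1) with hc₁
  set c₂ : ℝ := 5 * (8 * (lam + β)) with hc₂
  have hc₁0 : 0 ≤ c₁ := by positivity
  have hc₂0 : 0 ≤ c₂ := by positivity
  have hQ0 : 0 ≤ Q := by
    have h := (hQ 0 0).2
    exact le_trans (integral_nonneg fun z => Even.pow_nonneg ⟨p, by ring⟩ _) h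
  refine ⟨3 ^ (p - 1) * (c₁ ^ p + 2 * (c₂ ^ p * Q)), by positivity, fun N r hr => ?_⟩
  set P := pinnedChain ω₂ lam β γ with hP
  set μ₀ := P.gibbsMeasure (N + 1) T with hμ₀
  set M := ((μ₀.prod (gaussianReal 0 T.toNNReal)).prod wienerPair) with hM
  haveI : IsProbabilityMeasure μ₀ := pinnedChain_isProbabilityMeasure_gibbsMeasure hω hl hβ γ (N + 1) hT
  haveI : IsProbabilityMeasure M := by rw [hM]; infer_instance
  set rN : ℝ≥0 := ⟨r, hr⟩ with hrN
  have hrr : ((rN : ℝ≥0) : ℝ) = r := rfl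
  -- the two position processes
  set qf : (PhaseSpace (N + 1) × ℝ) × WienerPair → (Fin (N + 1) → ℝ) := fun q =>
    (P.solMap (N + 1) T T r q.1.1 (pairPath q.2)).1 with hqf
  set qr : (PhaseSpace (N + 1) × ℝ) × WienerPair → (Fin (N + 1) → ℝ) := fun q =>
    (P.solMap (N + 1) T T r ((q.1.1.1, Function.update q.1.1.2 0 q.1.2) : PhaseSpace (N + 1)) (pairPath q.2)).1
    with hqr
  have hqfm : Measurable qf := measurable_fst.comp (lightCone_measurable_solMap_fst hω hl hβ hγ N T r)
  have hqrm : Measurable qr := measurable_fst.comp (lightCone_measurable_solMap_resample hω hl hβ hγ N T r)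
  -- pointwise power-mean bound
  have hpt : ∀ q, (1 + 5 * ((ω₂ + 1) + 8 * (lam + β) * (‖qf q‖ ^ 2 + ‖qr q‖ ^ 2))) ^ p ≤
      3 ^ (p - 1) * (c₁ ^ p + c₂ ^ p * ‖qf q‖ ^ (2 * p) + c₂ ^ p * ‖qr q‖ ^ (2 * p)) := by
    intro q
    have e : 1 + 5 * ((ω₂ + 1) + 8 * (lam + β) * (‖qf q‖ ^ 2 + ‖qr q‖ ^ 2)) =
        c₁ + c₂ * ‖qf q‖ ^ 2 + c₂ * ‖qr q‖ ^ 2 := by rw [hc₁, hc₂]; ring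
    rw [e]
    refine (lightCone_add_three_pow_le hc₁0 (by positivity) (by positivity) hp).trans (le_of_eq ?_)
    rw [mul_pow c₂ (‖qf q‖ ^ 2) p, mul_pow c₂ (‖qr q‖ ^ 2) p, ← pow_mul, ← pow_mul]
  -- the Gibbs moments of the two copies
  have hgm : Measurable fun z : PhaseSpace (N + 1) => ENNReal.ofReal (‖z.1‖ ^ (2 * p)) :=
    (continuous_fst.norm.pow _).measurable.ennreal_ofReal
  have hnorm := lightCone_lintegral_norm_pow_le (γ := γ) (T := T) N p (hQ N)
  have h1 : ∫⁻ q, ENNReal.ofReal (‖qf q‖ ^ (2 * p)) ∂M ≤ ENNReal.ofReal (Q * (N + 1)) := by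
    have := lightCone_lintegral_solMap_fst hω hl hβ hγ N hT rN hgm
    rw [hrr] at this
    rw [hM, this]
    exact hnorm
  have h2 : ∫⁻ q, ENNReal.ofReal (‖qr q‖ ^ (2 * p)) ∂M ≤ ENNReal.ofReal (Q * (N + 1)) := by
    have := lightCone_lintegral_solMap_resample hω hl hβ hγ N hT rN hgm
    rw [hrr] at this
    rw [hM, this]
    exact hnorm
  -- assemble
  have hN1 : (1 : ℝ) ≤ (N : ℝ) + 1 := by have := Nat.cast_nonneg (α := ℝ) N; linarith
  calc ∫⁻ q, ENNReal.ofReal ((1 + 5 * ((ω₂ + 1) + 8 * (lam + β) * (‖qf q‖ ^ 2 + ‖qr q‖ ^ 2))) ^ p) ∂M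
      ≤ ∫⁻ q, (ENNReal.ofReal (3 ^ (p - 1) * c₁ ^ p) + ENNReal.ofReal (3 ^ (p - 1) * c₂ ^ p) * ENNReal.ofReal (‖qf q‖ ^ (2 * p)) +
          ENNReal.ofReal (3 ^ (p - 1) * c₂ ^ p) * ENNReal.ofReal (‖qr q‖ ^ (2 * p))) ∂M := by
        refine lintegral_mono fun q => ?_
        refine (ENNReal.ofReal_le_ofReal (hpt q)).trans (le_of_eq ?_)
        rw [← ENNReal.ofReal_mul (by positivity), ← ENNReal.ofReal_mul (by positivity),
          ← ENNReal.ofReal_add (by positivity) (by positivity), ← ENNReal.ofReal_add (by positivity) (by positivity)]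
        congr 1; ring
    _ = ENNReal.ofReal (3 ^ (p - 1) * c₁ ^ p) + ENNReal.ofReal (3 ^ (p - 1) * c₂ ^ p) * ∫⁻ q, ENNReal.ofReal (‖qf q‖ ^ (2 * p)) ∂M +
          ENNReal.ofReal (3 ^ (p - 1) * c₂ ^ p) * ∫⁻ q, ENNReal.ofReal (‖qr q‖ ^ (2 * p)) ∂M := by
        have hm1 : Measurable fun q => ENNReal.ofReal (‖qf q‖ ^ (2 * p)) := (hqfm.norm.pow_const _).ennreal_ofReal
        have hm2 : Measurable fun q => ENNReal.ofReal (‖qr q‖ ^ (2 * p)) := (hqrm.norm.pow_const _).ennreal_ofReal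
        rw [lintegral_add_right _ (hm2.const_mul _), lintegral_add_right _ (hm1.const_mul _), lintegral_const,
          measure_univ, mul_one, lintegral_const_mul _ hm1, lintegral_const_mul _ hm2]
    _ ≤ ENNReal.ofReal (3 ^ (p - 1) * c₁ ^ p) + ENNReal.ofReal (3 ^ (p - 1) * c₂ ^ p) * ENNReal.ofReal (Q * (N + 1)) +
          ENNReal.ofReal (3 ^ (p - 1) * c₂ ^ p) * ENNReal.ofReal (Q * (N + 1)) := by
        gcongr
    _ = ENNReal.ofReal (3 ^ (p - 1) * c₁ ^ p + 2 * (3 ^ (p - 1) * c₂ ^ p * (Q * (N + 1)))) := by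
        rw [← ENNReal.ofReal_mul (by positivity), ← ENNReal.ofReal_add (by positivity) (by positivity),
          ← ENNReal.ofReal_add (by positivity) (by positivity)]
        congr 1; ring
    _ ≤ ENNReal.ofReal (3 ^ (p - 1) * (c₁ ^ p + 2 * (c₂ ^ p * Q)) * (N + 1)) := by
        refine ENNReal.ofReal_le_ofReal ?_
        have h0 : 0 ≤ 3 ^ (p - 1) * c₁ ^ p := by positivity
        nlinarith [mul_le_mul_of_nonneg_left hN1 h0]

end Summit.AtomisticToContinuum.FouriersLaw.Theorems.PhononMeanFreePath

end
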